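import Summits.KontsevichZagierPeriods.KontsevichZagierPeriods.Theses.FermatIsogeny
import Summits.KontsevichZagierPeriods.KontsevichZagierPeriods.Theorems.FermatIsogenyBetaProductSectorStubProductValue
import Summits.KontsevichZagierPeriods.KontsevichZagierPeriods.Theorems.FermatIsogenyBetaProductSectorStubDirichletReassociation
import Summits.KontsevichZagierPeriods.KontsevichZagierPeriods.Theorems.FermatIsogenyBetaProductSectorStubLinearFactor
import Literature.NumberTheory.Transcendental.KZCubeProducts
import Literature.NumberTheory.Transcendental.KZProductIdeal
import Literature.NumberTheory.Transcendental.KZRelationsLE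

/-!
# `BetaProductSector` (stmt-KontsevichZagierPeriods-3898, route FermatIsogeny, rank 4) — birth skeleton

Crux: Conjecture 1 of Kontsevich–Zagier on the beta-PRODUCT sector (dimension 2): if
`B(a,b)B(e,d) = q · B(a',b')B(e',d')` with `q` real algebraic (all eight arguments positive rationals),
then the two product representations `[(0,1)², x^{a-1}(1-x)^{b-1} y^{e-1}(1-y)^{d-1}]` and
`[(0,1)², q · x^{a'-1}(1-x)^{b'-1} y^{e'-1}(1-y)^{d'-1}]` of equal value are `KZ.Equivalent`.

Line `birth` = the route's own PLAN for crux 4 ("BetaLinearSector ⊗ Dirichlet chaining ⊗ reflection ⊗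
translation, glued by KZProductIdeal") cut into a LENGTH-2 CHAIN NORMAL FORM. A product of two Beta values is
a weighted word `((a,b),(e,d); c)` (value `c · B(a,b) · B(e,d)`); the ELEMENTARY value-preserving steps are
(LIN) replace the first factor, `((a,b),(e,d); c) → ((a',b'),(e,d); c')` whenever `c B(a,b) = c' B(a',b')`
with `c, c'` real algebraic (the beta-LINEAR sector: symmetry, translation, Euler reflection and every
Koblitz–Rohrlich isogeny shadow are such steps); (SWAP) exchange the two factors; (DIR) Dirichlet
re-association `((a,b),(a+b,k); c) ↔ ((a,b+k),(b,k); c)` (`B(a,b)B(a+b,k) = B(a,b+k)B(b,k)`,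
Andrews–Askey–Roy Thm 1.8.1). Stubs:

* `stub_generation` (the bet, transcendence + combinatorics of the Beta symbol group, NO KZ content): every
  product identity `B(a,b)B(e,d) = q B(a',b')B(e',d')`, `q ∈ ℚ̄ ∩ ℝ`, is a finite chain of elementary steps
  from `((a,b),(e,d); 1)` to `((a',b'),(e',d'); q)` THROUGH LENGTH-2 WORDS ONLY. Why it might fail = the
  crux's own risk: Hodge-type Γ-monomials are standard over ℚ, not ℤ (Deligne–Koblitz–Ogus; Das2000
  2-torsion); a (2,2) identity that needs Gauss multiplication of order ≥ 4 with no length-2 detour.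
  Killable by a finite experiment (level-`N` words, Hodge-type criterion, connectivity of the step graph).
* `stub_productValue` (analysis, provable now): a representation pinned as
  `[(0,1)², c x^{a-1}(1-x)^{b-1}y^{e-1}(1-y)^{d-1}]` has value `c · Γ(a)Γ(b)/Γ(a+b) · Γ(e)Γ(d)/Γ(e+d)`
  (Tonelli on the cube + Euler's Beta integral `Selberg.integrableOn_Ioo_rpow_mul_one_sub_rpow_and_integral_eq`).
* `stub_linearFactor` (KZ, the LIN step tensored with `β(e,d)`): follows from route crux 3 `BetaLinearSector`
  with `IntegralRep.constMul`, `Equivalent.prod` and cube peeling (`KZCubeProducts`); the `c = 0` case is two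
  zero representations.
* `stub_dirichletReassociation` (KZ, the DIR step with an algebraic constant): the general `(a,b,k)` version of
  the PROVED route support `DirichletNinth` (stmt-3899): two rule-2 moves through the Dirichlet simplex, an
  affine involution, one Newton–Leibniz with a monomial primitive.

Composition (sorry-free): `betaProductSector_of_stubs : <stub₁-sig> → … → <stub₄-sig> → <crux, unfolded>`
— values ⇒ the Γ-identity (`stub_productValue` twice) ⇒ a chain (`stub_generation`) ⇒ induction along the
chain with the invariant "every representation pinned to the current weighted word is equivalent to `r`":
pinned representations EXIST at every positive word with algebraic weight (`KZ.exists_cubeBetaRep` +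
`constMul`), two representations pinned alike are equivalent (`KZ.of_sub_of_mem_relations_of_eqOn`), SWAP is
the coordinate relabelling `IntegralRep.reindex (Equiv.swap 0 1)` (`KZ.of_sub_of_reindex_mem_relations`), LIN
and DIR are the stubs (DIR backwards by symmetry). `BetaProductSector_of : BetaProductSector` feeds the four
stubs in BY NAME (the skeleton theorem the audit keys on). Disproof used: none on file (no `Disproof.lean`,
no dead lines; `ledger negatives` has no beta-sector statement).

RESHAPE (lead c1, 2026-08-17). `stub_productValue`, `stub_dirichletReassociation` and the tensored LIN step
MODULO crux 3 (`stub_linearFactor_of_betaLinearSector`) are LANDED under Theorems/ (namespace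
`Summit.KontsevichZagierPeriods.FermatIsogeny.BetaProductSectorStubs`) and fed in by name; the open stubs
are now `stub_generation` and `stub_betaLinearSector` (= route crux 3 `BetaLinearSector`, stmt-3897,
verbatim). FINDING (dossier `Lines/registered.dead.md`): `stub_generation` is false in substance — the
step graph on weight-0 Hodge classes of (2,2) words is DISCONNECTED from level 21/22/25 on (level 22:
`B(1/22,1/22)B(1/22,4/22) = q·B(1/22,2/22)B(1/22,8/22)`, `q = 2^{3/11} sin(5π/11)sin(4π/11)/(sin(9π/22)sin(3π/11))`,
by four Legendre duplications and three reflections; both nodes isolated at levels 22, 44, …, 132), so the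
line (chains through length-2 words, no cancellation) is dead; what survives is the sorry-free
`betaProductSector_of_stubs`: connected in the step graph ⇒ KZ-equivalent, given crux 3.
-/

set_option linter.dupNamespace false

noncomputable section

namespace Summit.KontsevichZagierPeriods.KontsevichZagierPeriods.Cruxes.BetaProductSector.Birth

open Summit.KontsevichZagierPeriods.KontsevichZagierPeriods.Theses.FermatIsogeny (BetaProductSector BetaLinearSector)

/-! ## The open stubs (after the c1 reshape: GENERATION and the beta-linear sector; VALUE, the tensored LIN
step modulo crux 3, and DIRICHLET are landed under Theorems/ and fed in by name below) -/

/-- Stub 1 — GENERATION (length-2 chain normal form of beta-product identities; the bet of the line).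
If `B(a,b)B(e,d) = q·B(a',b')B(e',d')` with `q` real algebraic, then `((a',b'),(e',d'); q)` is reached from
`((a,b),(e,d); 1)` by finitely many elementary value-preserving steps between weighted length-2 words:
LIN in the first factor (`c B(a,b) = c' B(a',b')`, `c, c'` real algebraic — by Wolfart–Wüstholz exactly the
Koblitz–Rohrlich coincidences, incl. symmetry / translation / reflection), SWAP of the two factors, Dirichlet
re-association `((a,b),(a+b,k); c) ↔ ((a,b+k),(b,k); c)`. `B(a,b) := Γ(a)Γ(b)/Γ(a+b)`. Why it might fail:
Das2000 2-torsion / a (2,2) identity forced through Gauss multiplication of order ≥ 4. Sources: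
AndrewsAskeyRoy1999 Thm 1.8.1, KoblitzRohrlich1978, WolfartWustholz1985, Deligne1982HodgeCycles §7, Das2000.
Size: conjecture-grade (finite experiment per level `N`). -/
theorem stub_generation : ∀ (a b e d a' b' e' d' : ℚ) (q : ℝ), 0 < a → 0 < b → 0 < e → 0 < d → 0 < a' → 0 < b' → 0 < e' → 0 < d' → IsAlgebraic ℚ q → (Real.Gamma a * Real.Gamma b / Real.Gamma ((a:ℝ) + b)) * (Real.Gamma e * Real.Gamma d / Real.Gamma ((e:ℝ) + d)) = q * ((Real.Gamma a' * Real.Gamma b' / Real.Gamma ((a':ℝ) + b')) * (Real.Gamma e' * Real.Gamma d' / Real.Gamma ((e':ℝ) + d'))) → Relation.ReflTransGen (fun (p p' : ((ℚ × ℚ) × (ℚ × ℚ)) × ℝ) => (∃ (a₁ b₁ a₂ b₂ e₁ d₁ : ℚ) (c₁ c₂ : ℝ), 0 < a₁ ∧ 0 < b₁ ∧ 0 < a₂ ∧ 0 < b₂ ∧ 0 < e₁ ∧ 0 < d₁ ∧ IsAlgebraic ℚ c₁ ∧ IsAlgebraic ℚ c₂ ∧ c₁ * (Real.Gamma a₁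 * Real.Gamma b₁ / Real.Gamma ((a₁:ℝ) + b₁)) = c₂ * (Real.Gamma a₂ * Real.Gamma b₂ / Real.Gamma ((a₂:ℝ) + b₂)) ∧ p = (((a₁, b₁), (e₁, d₁)), c₁) ∧ p' = (((a₂, b₂), (e₁, d₁)), c₂)) ∨ (∃ (a₁ b₁ e₁ d₁ : ℚ) (c₁ : ℝ), p = (((a₁, b₁), (e₁, d₁)), c₁) ∧ p' = (((e₁, d₁), (a₁, b₁)), c₁)) ∨ (∃ (a₁ b₁ k₁ : ℚ) (c₁ : ℝ), 0 < a₁ ∧ 0 < b₁ ∧ 0 < k₁ ∧ IsAlgebraic ℚ c₁ ∧ ((p = (((a₁, b₁), (a₁ + b₁, k₁)), c₁) ∧ p' = (((a₁, b₁ + k₁), (b₁, k₁)), c₁)) ∨ (p = (((a₁, b₁ + k₁), (b₁, k₁)), c₁) ∧ p' = (((a₁, b₁), (a₁ + b₁, k₁)), c₁))))) (((a, b), (e, d)), (1:ℝ)) (((a', b'), (e', d')), q) := by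
  sorry

/-- Stub 2 (reshape, lead c1, 2026-08-17) — THE BETA-LINEAR SECTOR, i.e. route crux 3
`FermatIsogeny.BetaLinearSector` (stmt-KontsevichZagierPeriods-3897) VERBATIM: the LIN step of the chain
needs Conjecture 1 for pairs (Beta representation, real-algebraic multiple of another one); the tensoring
with `β(e,d)` and the `c = 0` bookkeeping are LANDED
(`BetaProductSectorStubs.stub_linearFactor_of_betaLinearSector`, Theorems/FermatIsogenyBetaProductSectorStubLinearFactor.lean).
Not worked in this line (it has its own lead); recorded so that the skeleton names exactly what it hinges on.
[cite: KoblitzRohrlich1978, p. 1184] -/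
theorem stub_betaLinearSector : BetaLinearSector := by
  sorry

/-! ## Glue (sorry-free) -/

open Literature.NumberTheory.Transcendental

/-- Pinned product representations EXIST at every positive word with a real-algebraic weight: the cube Beta
representation of `(![a,e], ![b,d])` (`KZ.exists_cubeBetaRep`) scaled by `c` (`IntegralRep.constMul`).
[cite: KontsevichZagier2001, §1.1] -/
theorem exists_pinned (a b e d : ℚ) (c : ℝ) (ha : 0 < a) (hb : 0 < b) (he : 0 < e) (hd : 0 < d)
    (hc : IsAlgebraic ℚ c) :
    ∃ s : KZ.IntegralRep 2, s.domain = {x | ∀ i, x i ∈ Set.Ioo (0:ℝ) 1} ∧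
      Set.EqOn s.integrand (fun x => c * (x 0) ^ ((a:ℝ) - 1) * (1 - x 0) ^ ((b:ℝ) - 1) *
        (x 1) ^ ((e:ℝ) - 1) * (1 - x 1) ^ ((d:ℝ) - 1)) s.domain := by
  obtain ⟨r₀, hd₀, hi₀⟩ := KZ.exists_cubeBetaRep (N := 2) ![a, e] ![b, d]
    (Fin.forall_fin_two.2 ⟨by simpa using And.intro ha hb, by simpa using And.intro he hd⟩)
  refine ⟨r₀.constMul c hc, hd₀, fun x hx => ?_⟩
  have hx₀ : x ∈ r₀.domain := hx
  rw [KZ.IntegralRep.integrand_constMul]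
  simp only
  rw [hi₀ hx₀]
  simp only [Fin.prod_univ_two, Matrix.cons_val_zero, Matrix.cons_val_one]
  ring

/-- SWAP is a coordinate relabelling: a representation pinned to `((e,d),(a,b); c)` relabelled along
`Equiv.swap 0 1` is pinned to `((a,b),(e,d); c)` and equivalent to the original
(`KZ.of_sub_of_reindex_mem_relations`). [cite: KontsevichZagier2001, §1.2 rule (2)] -/
theorem swap_pinned (a b e d : ℚ) (c : ℝ) (t : KZ.IntegralRep 2)
    (htd : t.domain = {x | ∀ i, x i ∈ Set.Ioo (0:ℝ) 1})
    (hti : Set.EqOn t.integrand (fun x => c * (x 0) ^ ((e:ℝ) - 1) * (1 - x 0) ^ ((d:ℝ) - 1) *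
        (x 1) ^ ((a:ℝ) - 1) * (1 - x 1) ^ ((b:ℝ) - 1)) t.domain) :
    ∃ s : KZ.IntegralRep 2, s.domain = {x | ∀ i, x i ∈ Set.Ioo (0:ℝ) 1} ∧
      Set.EqOn s.integrand (fun x => c * (x 0) ^ ((a:ℝ) - 1) * (1 - x 0) ^ ((b:ℝ) - 1) *
        (x 1) ^ ((e:ℝ) - 1) * (1 - x 1) ^ ((d:ℝ) - 1)) s.domain ∧ KZ.Equivalent s t := by
  refine ⟨t.reindex (Equiv.swap (0 : Fin 2) 1), ?_, fun w hw => ?_, ?_⟩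
  · ext w
    simp only [KZ.IntegralRep.reindex_domain, htd, Set.mem_setOf_eq]
    constructor
    · intro h i
      simpa using h (Equiv.swap (0 : Fin 2) 1 i)
    · intro h i
      exact h _
  · have hw' : (fun i => w (Equiv.swap (0 : Fin 2) 1 i)) ∈ t.domain := hw
    rw [KZ.IntegralRep.reindex_integrand]
    simp only
    rw [hti hw']
    simp only [Equiv.swap_apply_left, Equiv.swap_apply_right]
    ring
  · have h : KZ.Equivalent t (t.reindex (Equiv.swap (0 : Fin 2) 1)) :=
      KZ.of_sub_of_reindex_mem_relations t (Equiv.swap (0 : Fin 2) 1)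
    exact h.symm

/-- Two representations pinned to the same weighted word are equivalent (one integrand-additivity move,
`KZ.of_sub_of_mem_relations_of_eqOn`). [cite: KontsevichZagier2001, §1.2 rule (1)] -/
theorem pinned_unique {f : (Fin 2 → ℝ) → ℝ} (s t : KZ.IntegralRep 2)
    (hsd : s.domain = {x | ∀ i, x i ∈ Set.Ioo (0:ℝ) 1}) (hsi : Set.EqOn s.integrand f s.domain)
    (htd : t.domain = {x | ∀ i, x i ∈ Set.Ioo (0:ℝ) 1}) (hti : Set.EqOn t.integrand f t.domain) :
    KZ.Equivalent s t :=
  KZ.of_sub_of_mem_relations_of_eqOn (htd.trans hsd.symm) fun x hx =>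
    (hsi hx).trans (hti (by rw [htd]; rw [hsd] at hx; exact hx)).symm

/-- The composition, arrow form: GENERATION → VALUE → LINEAR STEP → DIRICHLET STEP → the crux (UNFOLDED
verbatim, so that exactly one theorem of this file, `BetaProductSector_of`, concludes the crux by name).
[cite: KontsevichZagier2001, §1.2] -/
theorem betaProductSector_of_stubs
    (hgen : ∀ (a b e d a' b' e' d' : ℚ) (q : ℝ), 0 < a → 0 < b → 0 < e → 0 < d → 0 < a' → 0 < b' → 0 < e' → 0 < d' → IsAlgebraic ℚ q → (Real.Gamma a * Real.Gamma b / Real.Gamma ((a:ℝ) + b)) * (Real.Gamma e * Real.Gamma d / Real.Gamma ((e:ℝ) + d)) = q * ((Real.Gamma a' * Real.Gamma b' / Real.Gamma ((a':ℝ) + b')) * (Real.Gamma e' * Real.Gamma d' / Real.Gamma ((e':ℝ) + d'))) → Relation.ReflTransGen (fun (p p' : ((ℚ × ℚ) × (ℚ × ℚ)) × ℝ) => (∃ (a₁ b₁ a₂ b₂ e₁ d₁ : ℚ) (c₁ c₂ : ℝ), 0 < a₁ ∧ 0 < b₁ ∧ 0 < a₂ ∧ 0 < b₂ ∧ 0 <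 e₁ ∧ 0 < d₁ ∧ IsAlgebraic ℚ c₁ ∧ IsAlgebraic ℚ c₂ ∧ c₁ * (Real.Gamma a₁ * Real.Gamma b₁ / Real.Gamma ((a₁:ℝ) + b₁)) = c₂ * (Real.Gamma a₂ * Real.Gamma b₂ / Real.Gamma ((a₂:ℝ) + b₂)) ∧ p = (((a₁, b₁), (e₁, d₁)), c₁) ∧ p' = (((a₂, b₂), (e₁, d₁)), c₂)) ∨ (∃ (a₁ b₁ e₁ d₁ : ℚ) (c₁ : ℝ), p = (((a₁, b₁), (e₁, d₁)), c₁) ∧ p' = (((e₁, d₁), (a₁, b₁)), c₁)) ∨ (∃ (a₁ b₁ k₁ : ℚ) (c₁ : ℝ), 0 < a₁ ∧ 0 < b₁ ∧ 0 < k₁ ∧ IsAlgebraic ℚ c₁ ∧ ((p = (((a₁, b₁), (a₁ + b₁, k₁)), c₁) ∧ p' = (((a₁, b₁ + k₁), (b₁, k₁)), c₁)) ∨ (p = (((a₁, b₁ + k₁), (b₁, k₁)), c₁) ∧ p' = (((a₁, b₁), (a₁ + b₁, k₁)), c₁))))) (((a, b), (e, d)), (1:ℝ)) (((a', b'), (e',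 d')), q))
    (hval : ∀ (a b e d : ℚ) (c : ℝ), 0 < a → 0 < b → 0 < e → 0 < d → ∀ (r : Literature.NumberTheory.Transcendental.KZ.IntegralRep 2), r.domain = {x | ∀ i, x i ∈ Set.Ioo (0:ℝ) 1} → Set.EqOn r.integrand (fun x => c * (x 0) ^ ((a:ℝ) - 1) * (1 - x 0) ^ ((b:ℝ) - 1) * (x 1) ^ ((e:ℝ) - 1) * (1 - x 1) ^ ((d:ℝ) - 1)) r.domain → r.value = c * ((Real.Gamma a * Real.Gamma b / Real.Gamma ((a:ℝ) + b)) * (Real.Gamma e * Real.Gamma d / Real.Gamma ((e:ℝ) + d))))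
    (hlin : ∀ (a b a' b' e d : ℚ) (c c' : ℝ), 0 < a → 0 < b → 0 < a' → 0 < b' → 0 < e → 0 < d → IsAlgebraic ℚ c → IsAlgebraic ℚ c' → c * (Real.Gamma a * Real.Gamma b / Real.Gamma ((a:ℝ) + b)) = c' * (Real.Gamma a' * Real.Gamma b' / Real.Gamma ((a':ℝ) + b')) → ∀ (r r' : Literature.NumberTheory.Transcendental.KZ.IntegralRep 2), r.domain = {x | ∀ i, x i ∈ Set.Ioo (0:ℝ) 1} → Set.EqOn r.integrand (fun x => c * (x 0) ^ ((a:ℝ) - 1) * (1 - x 0) ^ ((b:ℝ) - 1) * (x 1) ^ ((e:ℝ) - 1) * (1 - x 1) ^ ((d:ℝ) - 1)) r.domain → r'.domain = {x | ∀ i, x i ∈ Set.Ioo (0:ℝ) 1} → Set.EqOn r'.integrand (fun x => c' * (x 0) ^ ((a':ℝ) - 1) * (1 - x 0) ^ ((b':ℝ) - 1) * (x 1) ^ ((e:ℝ) - 1) * (1 - x 1) ^ ((d:ℝ) - 1)) r'.domain → Literature.NumberTheory.Transcendental.KZ.Equivalent r r')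
    (hdir : ∀ (a b k : ℚ) (c : ℝ), 0 < a → 0 < b → 0 < k → IsAlgebraic ℚ c → ∀ (r r' : Literature.NumberTheory.Transcendental.KZ.IntegralRep 2), r.domain = {x | ∀ i, x i ∈ Set.Ioo (0:ℝ) 1} → Set.EqOn r.integrand (fun x => c * (x 0) ^ ((a:ℝ) - 1) * (1 - x 0) ^ ((b:ℝ) - 1) * (x 1) ^ (((a + b : ℚ):ℝ) - 1) * (1 - x 1) ^ ((k:ℝ) - 1)) r.domain → r'.domain = {x | ∀ i, x i ∈ Set.Ioo (0:ℝ) 1} → Set.EqOn r'.integrand (fun x => c * (x 0) ^ ((a:ℝ) - 1) * (1 - x 0) ^ (((b + k : ℚ):ℝ) - 1) * (x 1) ^ ((b:ℝ) - 1) * (1 - x 1) ^ ((k:ℝ) - 1)) r'.domain → Literature.NumberTheory.Transcendental.KZ.Equivalent r r') :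
    ∀ (a b e d a' b' e' d' : ℚ) (q : ℝ), 0 < a → 0 < b → 0 < e → 0 < d → 0 < a' → 0 < b' → 0 < e' → 0 < d' → IsAlgebraic ℚ q → ∀ (r r' : Literature.NumberTheory.Transcendental.KZ.IntegralRep 2), r.domain = {x | ∀ i, x i ∈ Set.Ioo (0:ℝ) 1} → Set.EqOn r.integrand (fun x => (x 0) ^ ((a:ℝ) - 1) * (1 - x 0) ^ ((b:ℝ) - 1) * (x 1) ^ ((e:ℝ) - 1) * (1 - x 1) ^ ((d:ℝ) - 1)) r.domain → r'.domain = {x | ∀ i, x i ∈ Set.Ioo (0:ℝ) 1} → Set.EqOn r'.integrand (fun x => q * (x 0) ^ ((a':ℝ) - 1) * (1 - x 0) ^ ((b':ℝ) - 1) * (x 1) ^ ((e':ℝ) - 1) * (1 - x 1) ^ ((d':ℝ) - 1)) r'.domain → r.value = r'.value → Literature.NumberTheory.Transcendental.KZ.Equivalent r r' := by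
  intro a b e d a' b' e' d' q ha hb he hd ha' hb' he' hd' hq r r' hrd hri hr'd hr'i hv
  -- `r` pinned with the weight `1`
  have hri₁ : Set.EqOn r.integrand (fun x => (1:ℝ) * (x 0) ^ ((a:ℝ) - 1) * (1 - x 0) ^ ((b:ℝ) - 1) *
      (x 1) ^ ((e:ℝ) - 1) * (1 - x 1) ^ ((d:ℝ) - 1)) r.domain := fun x hx => by
    simp only [hri hx, one_mul]
  -- the Γ-identity from the values
  have hΓ : (Real.Gamma a * Real.Gamma b / Real.Gamma ((a:ℝ) + b)) *
      (Real.Gamma e * Real.Gamma d / Real.Gamma ((e:ℝ) + d)) =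
      q * ((Real.Gamma a' * Real.Gamma b' / Real.Gamma ((a':ℝ) + b')) *
        (Real.Gamma e' * Real.Gamma d' / Real.Gamma ((e':ℝ) + d'))) := by
    have h₁ := hval a b e d 1 ha hb he hd r hrd hri₁
    have h₂ := hval a' b' e' d' q ha' hb' he' hd' r' hr'd hr'i
    rw [one_mul] at h₁
    rw [← h₁, ← h₂]
    exact hv
  have hchain := hgen a b e d a' b' e' d' q ha hb he hd ha' hb' he' hd' hq hΓ
  -- invariant along the chain: every representation pinned to the current weighted word is equivalent to `r`
  suffices H : ∀ p : ((ℚ × ℚ) × (ℚ × ℚ)) × ℝ,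
      Relation.ReflTransGen (fun (p p' : ((ℚ × ℚ) × (ℚ × ℚ)) × ℝ) => (∃ (a₁ b₁ a₂ b₂ e₁ d₁ : ℚ) (c₁ c₂ : ℝ), 0 < a₁ ∧ 0 < b₁ ∧ 0 < a₂ ∧ 0 < b₂ ∧ 0 < e₁ ∧ 0 < d₁ ∧ IsAlgebraic ℚ c₁ ∧ IsAlgebraic ℚ c₂ ∧ c₁ * (Real.Gamma a₁ * Real.Gamma b₁ / Real.Gamma ((a₁:ℝ) + b₁)) = c₂ * (Real.Gamma a₂ * Real.Gamma b₂ / Real.Gamma ((a₂:ℝ) + b₂)) ∧ p = (((a₁, b₁), (e₁, d₁)), c₁) ∧ p' = (((a₂, b₂), (e₁, d₁)), c₂)) ∨ (∃ (a₁ b₁ e₁ d₁ : ℚ) (c₁ : ℝ), p = (((a₁, b₁), (e₁, d₁)), c₁) ∧ p' = (((e₁, d₁), (a₁, b₁)), c₁)) ∨ (∃ (a₁ b₁ k₁ : ℚ) (c₁ : ℝ), 0 < a₁ ∧ 0 < b₁ ∧ 0 < k₁ ∧ IsAlgebraic ℚ c₁ ∧ ((p = (((a₁, b₁), (a₁ +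 b₁, k₁)), c₁) ∧ p' = (((a₁, b₁ + k₁), (b₁, k₁)), c₁)) ∨ (p = (((a₁, b₁ + k₁), (b₁, k₁)), c₁) ∧ p' = (((a₁, b₁), (a₁ + b₁, k₁)), c₁))))) (((a, b), (e, d)), (1:ℝ)) p →
      ∀ s : KZ.IntegralRep 2, s.domain = {x | ∀ i, x i ∈ Set.Ioo (0:ℝ) 1} →
        Set.EqOn s.integrand (fun x => p.2 * (x 0) ^ ((p.1.1.1:ℝ) - 1) * (1 - x 0) ^ ((p.1.1.2:ℝ) - 1) *
          (x 1) ^ ((p.1.2.1:ℝ) - 1) * (1 - x 1) ^ ((p.1.2.2:ℝ) - 1)) s.domain →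
        KZ.Equivalent r s by
    exact H _ hchain r' hr'd hr'i
  intro p hp
  induction hp with
  | refl =>
    intro s hsd hsi
    exact pinned_unique r s hrd hri₁ hsd hsi
  | tail _ hstep ih =>
    intro t htd hti
    rcases hstep with ⟨a₁, b₁, a₂, b₂, e₁, d₁, c₁, c₂, ha₁, hb₁, ha₂, hb₂, he₁, hd₁, hc₁, hc₂, hΓ₁, rfl, rfl⟩ |
        ⟨a₁, b₁, e₁, d₁, c₁, rfl, rfl⟩ | ⟨a₁, b₁, k₁, c₁, ha₁, hb₁, hk₁, hc₁, (⟨rfl, rfl⟩ | ⟨rfl, rfl⟩)⟩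
    · -- LIN in the first factor
      obtain ⟨s, hsd, hsi⟩ := exists_pinned a₁ b₁ e₁ d₁ c₁ ha₁ hb₁ he₁ hd₁ hc₁
      exact (ih s hsd hsi).trans
        (hlin a₁ b₁ a₂ b₂ e₁ d₁ c₁ c₂ ha₁ hb₁ ha₂ hb₂ he₁ hd₁ hc₁ hc₂ hΓ₁ s t hsd hsi htd hti)
    · -- SWAP of the two factors
      obtain ⟨s, hsd, hsi, hst⟩ := swap_pinned a₁ b₁ e₁ d₁ c₁ t htd hti
      exact (ih s hsd hsi).trans hst
    · -- Dirichlet re-association, forward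
      obtain ⟨s, hsd, hsi⟩ := exists_pinned a₁ b₁ (a₁ + b₁) k₁ c₁ ha₁ hb₁ (add_pos ha₁ hb₁) hk₁ hc₁
      exact (ih s hsd hsi).trans (hdir a₁ b₁ k₁ c₁ ha₁ hb₁ hk₁ hc₁ s t hsd hsi htd hti)
    · -- Dirichlet re-association, backward
      obtain ⟨s, hsd, hsi⟩ := exists_pinned a₁ (b₁ + k₁) b₁ k₁ c₁ ha₁ (add_pos hb₁ hk₁) hb₁ hk₁ hc₁
      exact (ih s hsd hsi).trans (hdir a₁ b₁ k₁ c₁ ha₁ hb₁ hk₁ hc₁ t s htd hti hsd hsi).symm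

/-- **The skeleton theorem** (concludes the crux BY NAME; sorries enter only through the four named stubs):
`BetaProductSector` from GENERATION, VALUE, the LINEAR STEP and the DIRICHLET STEP.
[cite: KontsevichZagier2001, §1.2 Conjecture 1] -/
theorem BetaProductSector_of : BetaProductSector :=
  betaProductSector_of_stubs stub_generation
    Summit.KontsevichZagierPeriods.FermatIsogeny.BetaProductSectorStubs.stub_productValue
    (Summit.KontsevichZagierPeriods.FermatIsogeny.BetaProductSectorStubs.stub_linearFactor_of_betaLinearSector
      stub_betaLinearSector)
    Summit.KontsevichZagierPeriods.FermatIsogeny.BetaProductSectorStubs.stub_dirichletReassociation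

end Summit.KontsevichZagierPeriods.KontsevichZagierPeriods.Cruxes.BetaProductSector.Birth

end
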